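import Summits.QuantumFields.BalabanUV.T4Continuum.Support.ShellMeasureLinearizedGammaTEnd
import Summits.QuantumFields.BalabanUV.T4Continuum.Support.ShellMeasureLinearizedGammaTLocalEnd

/-!
# `T4Continuum.ShellMeasureLinearizedGammaTSharp` — NE7c-S100 f3 «γ9″ THE SHARP W-d WINDOW»: THE W-d ENDs OF RECORD
# (S52 `realForm_chartData_gammaT`, S91 `realForm_chartData_gammaT_local`) RE-FIRED AT ANY CERTIFIED PAIR `(R, M_Q)` —
# analyticity radius and sup bound of the printed average in the chart as HYPOTHESES, (Q4) on that ball and p. 267's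
# `h`-identity DISCHARGED — so that the sharp pair `(1∕(16(d+1)L), M♯)` of S100 f2 (and any later one) plugs in BY NAME
(cell `pub-balaban`, sub-cell `t4`, spine estimate NE7c (node U5b); NE7c ROUND-2 crew, seat
`b2b-balaban-t4-ne7c-formalise-leaf-05` gen 10; row S100 of `t4/b2b-balaban-t4-ne7c-p1/LEAVES-NE7c-P1.md` (owner ruling
R-ne7cp1-g35-1 (c): f1∕f2 = leaf-06-g8 `ShellMeasureAverageLipschitz`∕`ShellMeasureAverageAnalyticB7Sharp`, f3∕f4 = this
seat); imports S52 f2 `ShellMeasureLinearizedGammaTEnd` and S91 f2 `ShellMeasureLinearizedGammaTLocalEnd` ONLY, every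
input BY NAME; [folklore]; 0 `def`, 0 `def … : Prop`, 0 sorry)

HONEST FRAMING.  Finite four-torus programme, rung (B)+1 only — NOT infinite volume, NOT a mass gap, NOT the Clay
problem, NOT summit progress; (B), `BetaPertHyp`, (B^μ) not consumed.  NE7c (`T4IndicatorShell.ShellWeightBound`) is
NOT PRINTED and NOT PROVED; «NE7c ⇐ the named binders».  KERNEL PLUMBING on OUR side of WALL §3 W-d: S52∕S91 hard-wire
S49 f2's radius `R = 1∕(2816(d+1)L)` and bound `M_Q = 1`; here the SAME six-clause conclusions are proved for every
`(R, M_Q)` at which the printed average `QtΓ L V c` is analytic with `‖·‖ ≤ M_Q` on `ball 0 R` — (Q4) on that ball by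
S51's germ propagation (as S52 §1, with the analyticity a hypothesis instead of S49's name) and the fibre ⋆-identity by
S50 f2 ∕ S91 f1 — so that row S100's sharp radius (f2, leaf-06-g8: NO Schwarz-at-0, `R♯ = 1∕(16(d+1)L)`) re-fires the
W-d ENDs in one line each (f4, with S97's numbers re-run).  Nothing printed is asserted ([Balaban1987RG1] p. 267 prints
no radius); S49∕S52∕S60∕S91∕S97 are untouched (twins, not edits); the END-II-final of record and THE ONE CALL are
unaffected; only WALL §2b row `S`'s «one explicit ceiling, ours, plug road only» moves (on f4).  NOTHING in the countdown
moves; spine PROVED 0∕9.  HONEST DEPENDENCY (cell): continuum YM on T⁴ ⇐ BetaPertH ∧ nine spine estimates (0/9 proved);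
BetaPertH ⇐ (D1) ∧ (D4) ∧ CAP+tail; G-an2-4 gates asym, D1 and NE2/3/4.

CONTENT.
* §1 **`QtΓ_conj_of_analytic`** — (Q4) `Q̃(B⋆) = Q̃(B)⋆` on ANY `ball 0 R` on which `QtΓ L V c` is analytic (S52 §1's
  route of record verbatim: S51 `conj_eqOn_ball_of_regime'` fed by S47 `star_Qtilde_gammaT`; the regime quantities are
  S49 f2's entire words, strictly in the regime at `0`).
* §2 **`realForm_chartData_gammaT_at`** — S52's END at `(R, M_Q)`: S52 f1 `realForm_chartData_gammaT_of` with (Q4) := §1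
  and `hhop0` := S50 f2 `hGen_star_gammaT_unitary`; inputs = print's `hL hVu hV hV' hε0 hε hW hbud` + `hR hQa hQM` + the
  window `9·Mq R M_Q·b·εw < 1`, `3εw ≤ R` + a real splitting `Ψ` of `TΓ`.
* §3 **`realForm_chartData_gammaT_local_at`** — S91's LOCATED END (loops at `c` only, `hopΓAt`∕`hΓAt`) at `(R, M_Q)`:
  S46 `exists_realForm_chartData_of_Q` BY NAME exactly as in S91, with §1 and S91 f1's `hopΓAt_star`.
* §4 `window_ok_M` (`εw := R²∕(18M_Q b + 3R + 1)` ⟹ `9·Mq R M_Q·b·εw < 1 ∧ 3εw ≤ R`; `M_Q = 1` is S52 f1 `window_ok`) and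
  **`realForm_chartData_gammaT_local_explicit_at`** — the located END with `εw` CHOSEN and `Ψ` SUPPLIED (S91
  `exists_splitting_gammaT_local`): hypotheses = print's located ones + unitarity + `(hR, hQa, hQM, 0 < M_Q)`.
* §5 `realForm_chartData_gammaT_local_explicit_at_S49` — the hypotheses `(hR, hQa, hQM)` INHABITED by the tree at S49 f2's
  pair `(1∕(2816(d+1)L), 1)` (consistency with S91's `_local_explicit`; the sharp pair plugs into the same slot in f4).
NOT HERE: the sharp instances at f2's `(R♯, M♯)` and S97's numbers re-run (f4 `ShellMeasureLinearizedWindowNumbersSharp`).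
-/

noncomputable section

open Set Metric Filter Topology

namespace Summit.QuantumFields.BalabanUV.T4Continuum.ShellMeasureLinearizedGammaTSharp

open Literature.MathematicalPhysics.QuantumFieldTheory.Balaban1983to89
open Literature.MathematicalPhysics.QuantumLattice (ZdEdge blockSites)
open B7BlockGeometry (qppBonds)
open B12HOperator267 (gammaT)
open B12AverageCorridor267 (Qtilde pert loopW avgM offAxis isAxisStraightFamily_gammaT hGen)
open Summit.QuantumFields.BalabanUV.Beta.LinearizingChange267FromQ (nonlin Mq)
open ShellMeasureLinearizedRealStructure (realSub incl reP)
open ShellMeasureLinearizedFromQ (exists_realForm_chartData_of_Q)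
open ShellMeasureAverageDerivative (hop_bound_nonneg)
open ShellMeasureAverageAnalyticB7 (pert_extend_zero expWord_gammaT expWord_loopW expWord_Ustr loops_small_gammaT
  exponent_analytic_and_bounded analyticOnNhd_Qtilde_gammaT norm_Qtilde_gammaT_le)
open ShellMeasureAverageReal (star_Qtilde_gammaT)
open ShellMeasureAverageHStructure (hGen_star_gammaT_unitary)
open ShellMeasureEquivariantGerm (conj_eqOn_ball_of_regime' norm_sub_one_lt_of_eq_one)
open ShellMeasureLinearizedGammaT (extend_star QtΓ QtΓ_zero hopΓ norm_hopΓ_le κ𝔸 κΓ κ𝔸_invol κΓ_invol TΓ hΓ winΓ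
  DtΓℝ realForm_chartData_gammaT_of)
open ShellMeasureLinearizedGammaTLocal (hopΓAt hΓAt fderiv_hopΓAt norm_hopΓAt_le hopΓAt_star
  hGenAt_star_gammaT_unitary exists_splitting_gammaT_local)

variable {d : ℕ} {𝔸 : Type*} [NormedRing 𝔸] [NormedAlgebra ℂ 𝔸] [CompleteSpace 𝔸] [NormOneClass 𝔸]
  [StarRing 𝔸] [CStarRing 𝔸] [StarModule ℂ 𝔸] {L : ℕ} {c : ZdEdge d}

/-! ## §1 (Q4) for the printed average on ANY ball of analyticity -/

/-- **(Q4) ON ANY BALL OF ANALYTICITY** — S52 §1 `QtΓ_conj` with S49 f2's analyticity REPLACED BY A HYPOTHESIS `hQa` on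
`ball 0 R`: row S51's germ propagation `conj_eqOn_ball_of_regime'` fed by row S47's `star_Qtilde_gammaT`; the three
`mlog`-regime quantities (block loops of `V′V` and of `V`, the quotient `M_c(V′V)M_c(V)⁻¹`) are S49 f2's entire words,
within the regime STRICTLY at `B′ = 0`. [folklore] -/
theorem QtΓ_conj_of_analytic (hL : 0 < L) {V : ZdEdge d → 𝔸ˣ} (hVu : ∀ b, (V b : 𝔸) ∈ unitary 𝔸)
    (hV : ∀ b, ‖((V b : 𝔸ˣ) : 𝔸)‖ ≤ 1) (hV' : ∀ b, ‖(((V b)⁻¹ : 𝔸ˣ) : 𝔸)‖ ≤ 1) {ε : ℝ} (hε0 : 0 ≤ ε) (hε : ε ≤ 1 / 8)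
    (hW : ∀ x ∈ offAxis L c, ‖((loopW L (fun U : ZdEdge d → 𝔸ˣ => gammaT L U) V c x : 𝔸ˣ) : 𝔸) - 1‖ ≤ ε)
    {R : ℝ} (hQa : AnalyticOnNhd ℂ (QtΓ L V c) (ball 0 R)) :
    ∀ B ∈ ball (0 : ↥(qppBonds L c) → 𝔸) R, QtΓ L V c (κΓ 𝔸 L c B) = κ𝔸 𝔸 (QtΓ L V c B) := by
  have hall : ∀ x ∈ blockSites L c.1, ‖((loopW L (fun U : ZdEdge d → 𝔸ˣ => gammaT L U) V c x : 𝔸ˣ) : 𝔸) - 1‖ ≤ ε :=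
    loops_small_gammaT hL hε0 hW
  have h13 : ε < 1 / 3 := by linarith
  refine conj_eqOn_ball_of_regime' (blockSites L c.1)
    (W := fun x (B : ↥(qppBonds L c) → 𝔸) => ((loopW L (fun U : ZdEdge d → 𝔸ˣ => gammaT L U)
      (pert (Function.extend Subtype.val B (0 : ZdEdge d → 𝔸)) V) c x : 𝔸ˣ) : 𝔸))
    (Z := fun B : ↥(qppBonds L c) → 𝔸 => ((avgM L (fun U : ZdEdge d → 𝔸ˣ => gammaT L U)
      (pert (Function.extend Subtype.val B (0 : ZdEdge d → 𝔸)) V) c *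
      (avgM L (fun U : ZdEdge d → 𝔸ˣ => gammaT L U) V c)⁻¹ : 𝔸ˣ) : 𝔸)) (r := 1 / 3) hQa ?_ ?_ ?_ ?_ ?_
  · -- S47: the ⋆-identity in the regime
    intro B hWB hZB
    show star (Qtilde L _ V _ c) = Qtilde L _ V (Function.extend Subtype.val (star B) (0 : ZdEdge d → 𝔸)) c
    rw [extend_star]
    exact star_Qtilde_gammaT hVu _ c hWB (fun x hx => (hall x hx).trans (by linarith)) hZB
  · -- continuity of the loops at 0 (S49's words are entire)
    intro x _
    exact ((expWord_loopW hV hV' (expWord_gammaT hL hV hV') x).an 0).continuousAt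
  · -- strict regime of the loops at 0
    intro x hx
    show ‖((loopW L _ (pert (Function.extend Subtype.val (0 : ↥(qppBonds L c) → 𝔸) (0 : ZdEdge d → 𝔸)) V) c x
      : 𝔸ˣ) : 𝔸) - 1‖ < 1 / 3
    rw [pert_extend_zero]
    exact (hall x hx).trans_lt h13
  · -- continuity of the quotient at 0: `M_c(V′V) = e^{S(B)}·T(B)` with `S` analytic at `0` (S49 f2) and `T` entire
    have hLr : (1 : ℝ) ≤ L := by exact_mod_cast hL
    have hS := (exponent_analytic_and_bounded (c := c) (w𝒯 := (d : ℝ) * L) hL hV hV' (by positivity)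
      (expWord_gammaT hL hV hV') hε hall 0
      (show ‖(0 : ↥(qppBonds L c) → 𝔸)‖ < 1 / (32 * (2 * ((d : ℝ) * L) + 2 * L)) by
        rw [norm_zero]; positivity)).1
    have hT := (expWord_Ustr (L := L) (c := c) hV hV' c).an 0
    have hA : AnalyticAt ℂ (fun B : ↥(qppBonds L c) → 𝔸 => ((avgM L (fun U : ZdEdge d → 𝔸ˣ => gammaT L U)
        (pert (Function.extend Subtype.val B (0 : ZdEdge d → 𝔸)) V) c : 𝔸ˣ) : 𝔸)) 0 :=
      ((NormedSpace.exp_analytic _).comp_of_eq hS rfl).mul hT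
    exact (hA.continuousAt.mul continuousAt_const)
  · -- the quotient is 1 at 0
    have h1 : ((avgM L (fun U : ZdEdge d → 𝔸ˣ => gammaT L U)
        (pert (Function.extend Subtype.val (0 : ↥(qppBonds L c) → 𝔸) (0 : ZdEdge d → 𝔸)) V) c *
        (avgM L (fun U : ZdEdge d → 𝔸ˣ => gammaT L U) V c)⁻¹ : 𝔸ˣ) : 𝔸) = 1 := by
      rw [pert_extend_zero, mul_inv_cancel, Units.val_one]
    exact norm_sub_one_lt_of_eq_one (r := 1 / 3)
      (Z := fun B : ↥(qppBonds L c) → 𝔸 => ((avgM L (fun U : ZdEdge d → 𝔸ˣ => gammaT L U)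
        (pert (Function.extend Subtype.val B (0 : ZdEdge d → 𝔸)) V) c *
        (avgM L (fun U : ZdEdge d → 𝔸ˣ => gammaT L U) V c)⁻¹ : 𝔸ˣ) : 𝔸)) h1 (by norm_num)

/-! ## §2 S52's END at any certified pair `(R, M_Q)` -/

section End

variable [FiniteDimensional ℂ 𝔸] [MeasurableSpace 𝔸] [BorelSpace 𝔸] [MeasurableSpace (↥(qppBonds L c) → 𝔸)]
  [BorelSpace (↥(qppBonds L c) → 𝔸)]

/-- **NE7c-S100 — S52's (LR)_j REAL-FORM CHART DATA FOR [B7] (15) AT ANY CERTIFIED PAIR `(R, M_Q)`.**  S52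
`realForm_chartData_gammaT` VERBATIM (the six clauses: `D̃` in the ball `4·(Mq R M_Q)·εw²`, print's fixed-point equation
`C̃(B − hD̃(B)) = D̃(B)`, `Q̃(B − hD̃(B)) = DQ̃(0)B` on `‖B‖ < εw`; the real chart `B ↦ B − hΓ(D̃_ℝ B)` measurable,
injective on `winΓ εw`, with derivative `id − hΓ ∘ (reP ∘ DD̃↾ℝ ∘ incl)` within it, linearizing `TΓ + C̃_ℝ` into
`(Ψ.symm ·).2`) — with S49 f2's `(1∕(2816(d+1)L), 1)` replaced by ANY `(R, M_Q)` such that `QtΓ L V c` is analytic with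
`‖·‖ ≤ M_Q` on `ball 0 R` (`hR hQa hQM`); (Q4) := §1, `hhop0` := S50 f2; the END := S52 f1
`realForm_chartData_gammaT_of` BY NAME. [folklore] -/
theorem realForm_chartData_gammaT_at (hL : 0 < L) {V : ZdEdge d → 𝔸ˣ} (hVu : ∀ b, (V b : 𝔸) ∈ unitary 𝔸)
    (hV : ∀ b, ‖((V b : 𝔸ˣ) : 𝔸)‖ ≤ 1) (hV' : ∀ b, ‖(((V b)⁻¹ : 𝔸ˣ) : 𝔸)‖ ≤ 1) {ε : ℝ} (hε0 : 0 ≤ ε) (hε : ε ≤ 1 / 8)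
    (hW : ∀ c', ∀ x ∈ offAxis L c', ‖((loopW L (fun U : ZdEdge d → 𝔸ˣ => gammaT L U) V c' x : 𝔸ˣ) : 𝔸) - 1‖ ≤ ε)
    (hbud : (L : ℝ) ^ d / L * (24 * ε) < 1) {R MQ εw : ℝ} (hR : 0 < R)
    (hQa : AnalyticOnNhd ℂ (QtΓ L V c) (ball 0 R))
    (hQM : ∀ B ∈ ball (0 : ↥(qppBonds L c) → 𝔸) R, ‖QtΓ L V c B‖ ≤ MQ)
    (hq : 9 * Mq R MQ * (((L : ℝ) ^ d / L) / (1 - (L : ℝ) ^ d / L * (24 * ε))) * εw < 1) (hRC : 3 * εw ≤ R)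
    {Kf : Type*} [NormedAddCommGroup Kf] [NormedSpace ℝ Kf] (Ψ : (Kf × realSub (κ𝔸 𝔸)) ≃L[ℝ] realSub (κΓ 𝔸 L c))
    (hΨ : ∀ y, (Ψ.symm y).2 = TΓ L V c y) :
    ∃ Dt : (↥(qppBonds L c) → 𝔸) → 𝔸,
      (∀ B : ↥(qppBonds L c) → 𝔸, ‖B‖ < εw →
        Dt B ∈ closedBall (0 : 𝔸) (4 * Mq R MQ * εw ^ 2) ∧
        nonlin (QtΓ L V c) (B - hopΓ hL V hε0 hε hW hV hV' hbud c (Dt B)) = Dt B ∧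
        QtΓ L V c (B - hopΓ hL V hε0 hε hW hV hV' hbud c (Dt B)) = fderiv ℂ (QtΓ L V c) 0 B) ∧
      Measurable (fun B : realSub (κΓ 𝔸 L c) => B - hΓ hL V hε0 hε hW hV hV' hbud c (DtΓℝ L c Dt εw B)) ∧
      InjOn (fun B : realSub (κΓ 𝔸 L c) => B - hΓ hL V hε0 hε hW hV hV' hbud c (DtΓℝ L c Dt εw B)) (winΓ L c εw) ∧
      (∀ B ∈ winΓ L c εw, HasFDerivWithinAt
          (fun B : realSub (κΓ 𝔸 L c) => B - hΓ hL V hε0 hε hW hV hV' hbud c (DtΓℝ L c Dt εw B))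
          (ContinuousLinearMap.id ℝ (realSub (κΓ 𝔸 L c)) - (hΓ hL V hε0 hε hW hV hV' hbud c).comp
            (reP (κ𝔸 𝔸) κ𝔸_invol ∘L (fderiv ℂ Dt (incl (κΓ 𝔸 L c) B)).restrictScalars ℝ ∘L incl (κΓ 𝔸 L c)))
          (winΓ L c εw) B) ∧
      ∀ B ∈ winΓ L c εw,
        TΓ L V c (B - hΓ hL V hε0 hε hW hV hV' hbud c (DtΓℝ L c Dt εw B)) +
          (fun y => reP (κ𝔸 𝔸) κ𝔸_invol (nonlin (QtΓ L V c) (incl (κΓ 𝔸 L c) y)))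
            (B - hΓ hL V hε0 hε hW hV hV' hbud c (DtΓℝ L c Dt εw B)) = (Ψ.symm B).2 :=
  realForm_chartData_gammaT_of hL hV hV' hε0 hε hW hbud hR hQa hQM (QtΓ_conj_of_analytic hL hVu hV hV' hε0 hε (hW c) hQa)
    (hGen_star_gammaT_unitary hL V hε0 hε hW hV hV' hbud hVu c) hq hRC Ψ hΨ

/-! ## §3 S91's LOCATED END at any certified pair `(R, M_Q)` -/

/-- **NE7c-S100 — S91's LOCATED (LR)_j REAL-FORM CHART DATA AT ANY CERTIFIED PAIR `(R, M_Q)`.**  S91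
`realForm_chartData_gammaT_local` VERBATIM (the regularity binder LOCATED: `ε`-regular off-axis block loops AT `c`;
p. 267's `h` := S91 f1 `hopΓAt`∕`hΓAt`) with `(1∕(2816(d+1)L), 1)` replaced by ANY certified `(R, M_Q)` (`hR hQa hQM`);
S46 `exists_realForm_chartData_of_Q` BY NAME with (Q4) := §1 and the fibre ⋆-identity := S91 f1
`hopΓAt_star ∘ hGenAt_star_gammaT_unitary`. [folklore] -/
theorem realForm_chartData_gammaT_local_at (hL : 0 < L) {V : ZdEdge d → 𝔸ˣ} (hVu : ∀ b, (V b : 𝔸) ∈ unitary 𝔸)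
    (hV : ∀ b, ‖((V b : 𝔸ˣ) : 𝔸)‖ ≤ 1) (hV' : ∀ b, ‖(((V b)⁻¹ : 𝔸ˣ) : 𝔸)‖ ≤ 1) {ε : ℝ} (hε0 : 0 ≤ ε) (hε : ε ≤ 1 / 8)
    (hWc : ∀ x ∈ offAxis L c, ‖((loopW L (fun U : ZdEdge d → 𝔸ˣ => gammaT L U) V c x : 𝔸ˣ) : 𝔸) - 1‖ ≤ ε)
    (hbud : (L : ℝ) ^ d / L * (24 * ε) < 1) {R MQ εw : ℝ} (hR : 0 < R)
    (hQa : AnalyticOnNhd ℂ (QtΓ L V c) (ball 0 R))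
    (hQM : ∀ B ∈ ball (0 : ↥(qppBonds L c) → 𝔸) R, ‖QtΓ L V c B‖ ≤ MQ)
    (hq : 9 * Mq R MQ * (((L : ℝ) ^ d / L) / (1 - (L : ℝ) ^ d / L * (24 * ε))) * εw < 1) (hRC : 3 * εw ≤ R)
    {Kf : Type*} [NormedAddCommGroup Kf] [NormedSpace ℝ Kf] (Ψ : (Kf × realSub (κ𝔸 𝔸)) ≃L[ℝ] realSub (κΓ 𝔸 L c))
    (hΨ : ∀ y, (Ψ.symm y).2 = TΓ L V c y) :
    ∃ Dt : (↥(qppBonds L c) → 𝔸) → 𝔸,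
      (∀ B : ↥(qppBonds L c) → 𝔸, ‖B‖ < εw →
        Dt B ∈ closedBall (0 : 𝔸) (4 * Mq R MQ * εw ^ 2) ∧
        nonlin (QtΓ L V c) (B - hopΓAt hL V hε0 hε c hWc hV hV' hbud (Dt B)) = Dt B ∧
        QtΓ L V c (B - hopΓAt hL V hε0 hε c hWc hV hV' hbud (Dt B)) = fderiv ℂ (QtΓ L V c) 0 B) ∧
      Measurable (fun B : realSub (κΓ 𝔸 L c) => B - hΓAt hL V hε0 hε c hWc hV hV' hbud (DtΓℝ L c Dt εw B)) ∧
      InjOn (fun B : realSub (κΓ 𝔸 L c) => B - hΓAt hL V hε0 hε c hWc hV hV' hbud (DtΓℝ L c Dt εw B)) (winΓ L c εw) ∧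
      (∀ B ∈ winΓ L c εw, HasFDerivWithinAt
          (fun B : realSub (κΓ 𝔸 L c) => B - hΓAt hL V hε0 hε c hWc hV hV' hbud (DtΓℝ L c Dt εw B))
          (ContinuousLinearMap.id ℝ (realSub (κΓ 𝔸 L c)) - (hΓAt hL V hε0 hε c hWc hV hV' hbud).comp
            (reP (κ𝔸 𝔸) κ𝔸_invol ∘L (fderiv ℂ Dt (incl (κΓ 𝔸 L c) B)).restrictScalars ℝ ∘L incl (κΓ 𝔸 L c)))
          (winΓ L c εw) B) ∧
      ∀ B ∈ winΓ L c εw,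
        TΓ L V c (B - hΓAt hL V hε0 hε c hWc hV hV' hbud (DtΓℝ L c Dt εw B)) +
          (fun y => reP (κ𝔸 𝔸) κ𝔸_invol (nonlin (QtΓ L V c) (incl (κΓ 𝔸 L c) y)))
            (B - hΓAt hL V hε0 hε c hWc hV hV' hbud (DtΓℝ L c Dt εw B)) = (Ψ.symm B).2 := by
  have hF : HasFDerivAt (QtΓ L V c) (fderiv ℂ (QtΓ L V c) 0) 0 :=
    (hQa 0 (mem_ball_self hR)).differentiableAt.hasFDerivAt
  exact exists_realForm_chartData_of_Q κ𝔸_invol κΓ_invol hR hQa (QtΓ_zero L V c) hQM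
    (QtΓ_conj_of_analytic hL hVu hV hV' hε0 hε hWc hQa) (fderiv_hopΓAt hL V hε0 hε c hWc hV hV' hbud hF)
    (hop_bound_nonneg hL hbud) (norm_hopΓAt_le hL V hε0 hε c hWc hV hV' hbud)
    (hopΓAt_star hL V hε0 hε c hWc hV hV' hbud (hGenAt_star_gammaT_unitary hL V hε0 hε c hWc hV hV' hbud hVu))
    hq hRC Ψ hΨ

/-! ## §4 The window at `(R, M_Q)`: `εw := R²∕(18M_Q b + 3R + 1)`; the located END fully explicit -/

omit [NormOneClass 𝔸] [StarRing 𝔸] [CStarRing 𝔸] [StarModule ℂ 𝔸] [FiniteDimensional ℂ 𝔸] [MeasurableSpace 𝔸]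
  [BorelSpace 𝔸] [MeasurableSpace (↥(qppBonds L c) → 𝔸)] [BorelSpace (↥(qppBonds L c) → 𝔸)] in
/-- **THE WINDOW NUMERICS AT `(R, M_Q)` ARE SATISFIABLE, EXPLICITLY**: for `R, M_Q > 0`, `b ≥ 0`, the radius
`εw := R²∕(18M_Q b + 3R + 1)` satisfies `9·(Mq R M_Q)·b·εw < 1` and `3εw ≤ R` (`Mq R M_Q = 2M_Q∕R²`; at `M_Q = 1` this is
S52 f1 `window_ok`). [folklore] -/
theorem window_ok_M {R b MQ : ℝ} (hR : 0 < R) (hb : 0 ≤ b) (hMQ : 0 < MQ) :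
    9 * Mq R MQ * b * (R ^ 2 / (18 * MQ * b + 3 * R + 1)) < 1 ∧ 3 * (R ^ 2 / (18 * MQ * b + 3 * R + 1)) ≤ R := by
  have hD : 0 < 18 * MQ * b + 3 * R + 1 := by positivity
  have hR2 : 0 < R ^ 2 := by positivity
  constructor
  · unfold Mq
    rw [show 9 * (2 * MQ / R ^ 2) * b * (R ^ 2 / (18 * MQ * b + 3 * R + 1)) = 18 * MQ * b / (18 * MQ * b + 3 * R + 1) by
      field_simp; ring]
    rw [div_lt_one hD]
    linarith
  · rw [show 3 * (R ^ 2 / (18 * MQ * b + 3 * R + 1)) = R * (3 * R / (18 * MQ * b + 3 * R + 1)) by ring]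
    have h1 : 3 * R / (18 * MQ * b + 3 * R + 1) ≤ 1 := by
      rw [div_le_one hD]; nlinarith
    calc R * (3 * R / (18 * MQ * b + 3 * R + 1)) ≤ R * 1 := mul_le_mul_of_nonneg_left h1 hR.le
      _ = R := mul_one R

/-- **NE7c-S100 — S91's LOCATED END AT `(R, M_Q)`, FULLY EXPLICIT: the located loop binder + unitarity + the certified
pair `(hR, hQa, hQM)` and NOTHING ELSE** — the window radius CHOSEN, `εw := R²∕(18M_Q b + 3R + 1)`,
`b = (Lᵈ∕L)∕(1 − (Lᵈ∕L)·24ε)` (`window_ok_M`), and the real splitting `Ψ` SUPPLIED (S91 `exists_splitting_gammaT_local`);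
conclusion = §3's six clauses at that `εw`. [folklore] -/
theorem realForm_chartData_gammaT_local_explicit_at (hL : 0 < L) {V : ZdEdge d → 𝔸ˣ}
    (hVu : ∀ b, (V b : 𝔸) ∈ unitary 𝔸)
    (hV : ∀ b, ‖((V b : 𝔸ˣ) : 𝔸)‖ ≤ 1) (hV' : ∀ b, ‖(((V b)⁻¹ : 𝔸ˣ) : 𝔸)‖ ≤ 1) {ε : ℝ} (hε0 : 0 ≤ ε) (hε : ε ≤ 1 / 8)
    (hWc : ∀ x ∈ offAxis L c, ‖((loopW L (fun U : ZdEdge d → 𝔸ˣ => gammaT L U) V c x : 𝔸ˣ) : 𝔸) - 1‖ ≤ ε)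
    (hbud : (L : ℝ) ^ d / L * (24 * ε) < 1) {R MQ : ℝ} (hR : 0 < R) (hMQ : 0 < MQ)
    (hQa : AnalyticOnNhd ℂ (QtΓ L V c) (ball 0 R))
    (hQM : ∀ B ∈ ball (0 : ↥(qppBonds L c) → 𝔸) R, ‖QtΓ L V c B‖ ≤ MQ) :
    ∃ (εw : ℝ) (Ψ : (LinearMap.ker ((TΓ L V c : realSub (κΓ 𝔸 L c) →L[ℝ] realSub (κ𝔸 𝔸)) :
        realSub (κΓ 𝔸 L c) →ₗ[ℝ] realSub (κ𝔸 𝔸)) × realSub (κ𝔸 𝔸)) ≃L[ℝ] realSub (κΓ 𝔸 L c))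
      (Dt : (↥(qppBonds L c) → 𝔸) → 𝔸),
      εw = R ^ 2 / (18 * MQ * (((L : ℝ) ^ d / L) / (1 - (L : ℝ) ^ d / L * (24 * ε))) + 3 * R + 1) ∧
      (∀ y, (Ψ.symm y).2 = TΓ L V c y) ∧
      (∀ B : ↥(qppBonds L c) → 𝔸, ‖B‖ < εw →
        Dt B ∈ closedBall (0 : 𝔸) (4 * Mq R MQ * εw ^ 2) ∧
        nonlin (QtΓ L V c) (B - hopΓAt hL V hε0 hε c hWc hV hV' hbud (Dt B)) = Dt B ∧
        QtΓ L V c (B - hopΓAt hL V hε0 hε c hWc hV hV' hbud (Dt B)) = fderiv ℂ (QtΓ L V c) 0 B) ∧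
      Measurable (fun B : realSub (κΓ 𝔸 L c) => B - hΓAt hL V hε0 hε c hWc hV hV' hbud (DtΓℝ L c Dt εw B)) ∧
      InjOn (fun B : realSub (κΓ 𝔸 L c) => B - hΓAt hL V hε0 hε c hWc hV hV' hbud (DtΓℝ L c Dt εw B)) (winΓ L c εw) ∧
      (∀ B ∈ winΓ L c εw, HasFDerivWithinAt
          (fun B : realSub (κΓ 𝔸 L c) => B - hΓAt hL V hε0 hε c hWc hV hV' hbud (DtΓℝ L c Dt εw B))
          (ContinuousLinearMap.id ℝ (realSub (κΓ 𝔸 L c)) - (hΓAt hL V hε0 hε c hWc hV hV' hbud).comp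
            (reP (κ𝔸 𝔸) κ𝔸_invol ∘L (fderiv ℂ Dt (incl (κΓ 𝔸 L c) B)).restrictScalars ℝ ∘L incl (κΓ 𝔸 L c)))
          (winΓ L c εw) B) ∧
      ∀ B ∈ winΓ L c εw,
        TΓ L V c (B - hΓAt hL V hε0 hε c hWc hV hV' hbud (DtΓℝ L c Dt εw B)) +
          (fun y => reP (κ𝔸 𝔸) κ𝔸_invol (nonlin (QtΓ L V c) (incl (κΓ 𝔸 L c) y)))
            (B - hΓAt hL V hε0 hε c hWc hV hV' hbud (DtΓℝ L c Dt εw B)) = (Ψ.symm B).2 := by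
  obtain ⟨hq, hRC⟩ := window_ok_M hR (hop_bound_nonneg hL hbud) hMQ
  obtain ⟨Ψ, hΨ⟩ := exists_splitting_gammaT_local (c := c) hL hVu hV hV' hε0 hε hWc hbud
  obtain ⟨Dt, h⟩ := realForm_chartData_gammaT_local_at hL hVu hV hV' hε0 hε hWc hbud hR hQa hQM hq hRC Ψ hΨ
  exact ⟨_, Ψ, Dt, rfl, hΨ, h⟩

/-! ## §5 Consistency instance: at S49 f2's pair `(1∕(2816(d+1)L), 1)` the generic located END is inhabited -/

/-- **THE HYPOTHESES `(hR, hQa, hQM)` ARE INHABITED BY THE TREE** at S49 f2's pair: `R := 1∕(2816(d+1)L)`, `M_Q := 1`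
(`ShellMeasureAverageAnalyticB7.analyticOnNhd_Qtilde_gammaT` ∕ `norm_Qtilde_gammaT_le`) — §4 then returns S91's
`realForm_chartData_gammaT_local_explicit` window `εw = R²∕(18b + 3R + 1)` (same six clauses); the sharp pair of S100 f2
plugs into the same slot (f4). [folklore] -/
theorem realForm_chartData_gammaT_local_explicit_at_S49 (hL : 0 < L) {V : ZdEdge d → 𝔸ˣ}
    (hVu : ∀ b, (V b : 𝔸) ∈ unitary 𝔸)
    (hV : ∀ b, ‖((V b : 𝔸ˣ) : 𝔸)‖ ≤ 1) (hV' : ∀ b, ‖(((V b)⁻¹ : 𝔸ˣ) : 𝔸)‖ ≤ 1) {ε : ℝ} (hε0 : 0 ≤ ε) (hε : ε ≤ 1 / 8)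
    (hWc : ∀ x ∈ offAxis L c, ‖((loopW L (fun U : ZdEdge d → 𝔸ˣ => gammaT L U) V c x : 𝔸ˣ) : 𝔸) - 1‖ ≤ ε)
    (hbud : (L : ℝ) ^ d / L * (24 * ε) < 1) :
    ∃ (εw : ℝ) (Ψ : (LinearMap.ker ((TΓ L V c : realSub (κΓ 𝔸 L c) →L[ℝ] realSub (κ𝔸 𝔸)) :
        realSub (κΓ 𝔸 L c) →ₗ[ℝ] realSub (κ𝔸 𝔸)) × realSub (κ𝔸 𝔸)) ≃L[ℝ] realSub (κΓ 𝔸 L c))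
      (Dt : (↥(qppBonds L c) → 𝔸) → 𝔸),
      εw = (1 / (2816 * ((d : ℝ) + 1) * L)) ^ 2 /
          (18 * 1 * (((L : ℝ) ^ d / L) / (1 - (L : ℝ) ^ d / L * (24 * ε))) + 3 * (1 / (2816 * ((d : ℝ) + 1) * L)) + 1) ∧
      (∀ y, (Ψ.symm y).2 = TΓ L V c y) ∧
      (∀ B : ↥(qppBonds L c) → 𝔸, ‖B‖ < εw →
        Dt B ∈ closedBall (0 : 𝔸) (4 * Mq (1 / (2816 * ((d : ℝ) + 1) * L)) 1 * εw ^ 2) ∧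
        nonlin (QtΓ L V c) (B - hopΓAt hL V hε0 hε c hWc hV hV' hbud (Dt B)) = Dt B ∧
        QtΓ L V c (B - hopΓAt hL V hε0 hε c hWc hV hV' hbud (Dt B)) = fderiv ℂ (QtΓ L V c) 0 B) ∧
      Measurable (fun B : realSub (κΓ 𝔸 L c) => B - hΓAt hL V hε0 hε c hWc hV hV' hbud (DtΓℝ L c Dt εw B)) ∧
      InjOn (fun B : realSub (κΓ 𝔸 L c) => B - hΓAt hL V hε0 hε c hWc hV hV' hbud (DtΓℝ L c Dt εw B)) (winΓ L c εw) ∧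
      (∀ B ∈ winΓ L c εw, HasFDerivWithinAt
          (fun B : realSub (κΓ 𝔸 L c) => B - hΓAt hL V hε0 hε c hWc hV hV' hbud (DtΓℝ L c Dt εw B))
          (ContinuousLinearMap.id ℝ (realSub (κΓ 𝔸 L c)) - (hΓAt hL V hε0 hε c hWc hV hV' hbud).comp
            (reP (κ𝔸 𝔸) κ𝔸_invol ∘L (fderiv ℂ Dt (incl (κΓ 𝔸 L c) B)).restrictScalars ℝ ∘L incl (κΓ 𝔸 L c)))
          (winΓ L c εw) B) ∧
      ∀ B ∈ winΓ L c εw,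
        TΓ L V c (B - hΓAt hL V hε0 hε c hWc hV hV' hbud (DtΓℝ L c Dt εw B)) +
          (fun y => reP (κ𝔸 𝔸) κ𝔸_invol (nonlin (QtΓ L V c) (incl (κΓ 𝔸 L c) y)))
            (B - hΓAt hL V hε0 hε c hWc hV hV' hbud (DtΓℝ L c Dt εw B)) = (Ψ.symm B).2 := by
  have hLr : (0 : ℝ) < L := by exact_mod_cast hL
  have hR : (0 : ℝ) < 1 / (2816 * ((d : ℝ) + 1) * L) := by positivity
  have hQM : ∀ B ∈ ball (0 : ↥(qppBonds L c) → 𝔸) (1 / (2816 * ((d : ℝ) + 1) * L)), ‖QtΓ L V c B‖ ≤ 1 := by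
    intro B hB
    rw [mem_ball_zero_iff] at hB
    refine (norm_Qtilde_gammaT_le hL hV hV' hε0 hε hWc hB).trans ?_
    have hK : (0 : ℝ) < 2816 * ((d : ℝ) + 1) * L := by positivity
    calc 2816 * ((d : ℝ) + 1) * L * ‖B‖ ≤ 2816 * ((d : ℝ) + 1) * L * (1 / (2816 * ((d : ℝ) + 1) * L)) :=
          mul_le_mul_of_nonneg_left hB.le hK.le
      _ = 1 := mul_one_div_cancel hK.ne'
  exact realForm_chartData_gammaT_local_explicit_at hL hVu hV hV' hε0 hε hWc hbud hR one_pos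
    (analyticOnNhd_Qtilde_gammaT hL hV hV' hε0 hε hWc) hQM

end End

end Summit.QuantumFields.BalabanUV.T4Continuum.ShellMeasureLinearizedGammaTSharp
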